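import Summits.NavierStokesRegularity.OSWSelfSimilar.SheetRLinearisedFormBounds
import Literature.Analysis.OperatorTheory.LionsSolutionOperator
import HarnessLib

/-!
# SHEET-ℝ frame, MODEL ASSEMBLY layer 3d: the BOUNDED LINEAR SOLUTION OPERATOR `S : L²_w →L E` of the linearised sheet operator,
# and its uniqueness

HONEST FRAMING (cell ns-blowup GROUP B / zone Z3, cases Z3-SR-CERT (the `S` of `CertificateViscousSheetR.existsUnique_fixedPoint_of_row_w`) and
Z3-SR-SPEC ((P1)-existence: the resolvent as a single-valued bounded operator); 1-D MODEL certificate frame (viscous gCLM/OSW sheet on the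
line); not Euler/NS; «violates: none — MODEL»). Nothing here asserts that a profile exists, and the COERCIVITY of the linearised form on
compactly supported tests — the certificate's (C1), interval arithmetic — enters as the HYPOTHESIS `hcoer`.

THE THEOREM (`exists_solutionOperator`).  `L > 0`; drift `d`, potential `V` a.e.-strongly measurable, `|d(ξ)| ≤ D₀ + D₁|ξ|`, `|V| ≤ V₀`
(`B_λ = −∂² + (½ξ + a𝒰̄)∂ + (1 − HΩ̄ + λχ)` is in the class); `κ > 0` with `κ(‖v₁‖²_w + ¼‖v‖²_w) ≤ linForm(v; v)` for every compactly supported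
odd energy-class test `(v, v₁)`.  THEN there is a bounded LINEAR map **`S : W L →L[ℝ] Esp L hL`** (`W L = L²_w`, `Esp` = the energy Hilbert
space of `SheetREnergySpace`) such that for every `g ∈ L²_w` the profile `u = prim (der (S g))`, `u₁ = der (S g)` (`der p` = the second
component of `p` as a function) solves the WEAK EQUATION `linForm L d V u u₁ v v₁ = ∫ (L²+ξ²) g v` against every compactly supported test, with
**`‖S g‖_E ≤ (2/κ)‖g‖_w`**; and (`solution_unique`) any two energy-space weak solutions with the same right-hand side coincide, so EVERY
energy-space weak solution with datum `g` IS `S g`.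

THE PROOF = one instantiation of `Literature.Analysis.OperatorTheory.exists_solutionOperator_of_coercive` (Lions' theorem in operator form)
with `F := Esp L hL`, `Φ := testSpace`, `j := jmap`, `q := ‖jmap ·‖` (`C = 1`), `E := Eform` (the weak form as a bilinear map; its fixed-test
bound is `SheetRLinearisedFormBounds.abs_linForm_le`), `α := κ`, `P g v := ∫ w g v` (`C_P = 2` from `‖v‖_w ≤ 2‖jmap(v,v₁)‖`), plus
uniqueness from `SheetRLinearisedUniqueness.weak_solution_unique` and injectivity of `p ↦ prim (der p)` on `Esp`.  One abbreviation (`der`) and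
two bundled maps (`Eform`, `Pdata`); no named fact.  WHAT THIS IS NOT: not NS; not the Woodbury/Neumann step from `B_λ⁻¹` to `DG(Ω̄)⁻¹`, not the
interval arithmetic; no number of record moves.
-/

noncomputable section

namespace Summit.NavierStokesRegularity.OSWSelfSimilar
namespace SheetRSolutionOperator

open _root_.MeasureTheory _root_.Set _root_.Filter _root_.Real SheetRWeakProfilePV SheetRWeakToStrong SheetREnergyClass SheetRWeightedMeasure
  SheetRLinearisedTests SheetREnergySpace SheetRTestSpace SheetRLinearisedFormBounds Literature.Analysis.OperatorTheory
open scoped Topology ENNReal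

/-- The derivative component `p₁` of an energy-space element, as a function on `ℝ` (the profile is `prim (der p)`). [folklore] -/
abbrev der {L : ℝ} {hL : 0 < L} (p : Esp L hL) : ℝ → ℝ := (((p : WithLp 2 (W L × W L)).snd : W L) : ℝ → ℝ)

/-- Unfolding `der`. [folklore] -/
theorem der_def {L : ℝ} {hL : 0 < L} (p : Esp L hL) : der p = (((p : WithLp 2 (W L × W L)).snd : W L) : ℝ → ℝ) := rfl

/-- `der` is additive up to a Lebesgue-null set, and `prim ∘ der` is additive. [folklore] -/
theorem der_add {L : ℝ} (hL : 0 < L) (p q : Esp L hL) :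
    (der (p + q) =ᵐ[volume] fun y => der p y + der q y) ∧ prim (der (p + q)) = fun x => prim (der p) x + prim (der q) x := by
  have e : (((p + q : Esp L hL) : WithLp 2 (W L × W L)).snd : W L) =
      ((p : WithLp 2 (W L × W L)).snd : W L) + ((q : WithLp 2 (W L × W L)).snd : W L) := by
    rw [Submodule.coe_add, WithLp.add_snd]
  refine ⟨?_, ?_⟩
  · rw [der_def, e]; exact ae_volume_of_ae_μw hL (Lp.coeFn_add _ _)
  · rw [der_def, e]; exact prim_add hL _ _

/-- `der` is homogeneous up to a Lebesgue-null set, and `prim ∘ der` is homogeneous. [folklore] -/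
theorem der_smul {L : ℝ} (hL : 0 < L) (c : ℝ) (p : Esp L hL) :
    (der (c • p) =ᵐ[volume] fun y => c * der p y) ∧ prim (der (c • p)) = fun x => c * prim (der p) x := by
  have e : (((c • p : Esp L hL) : WithLp 2 (W L × W L)).snd : W L) = c • ((p : WithLp 2 (W L × W L)).snd : W L) := by
    rw [Submodule.coe_smul, WithLp.smul_snd]
  refine ⟨?_, ?_⟩
  · rw [der_def, e]
    exact (ae_volume_of_ae_μw hL (Lp.coeFn_smul c _)).mono fun y hy => by rw [hy, Pi.smul_apply, smul_eq_mul]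
  · rw [der_def, e]; exact prim_smul hL c _

/-- The profile of an energy-space element: measurability and weights of `(prim (der p), der p)`, with `√∫w(prim (der p))² = 2‖p₀‖`,
`√∫w(der p)² = ‖p₁‖`. [folklore] -/
theorem profile_facts {L : ℝ} (hL : 0 < L) (p : Esp L hL) :
    AEStronglyMeasurable (prim (der p)) volume ∧ AEStronglyMeasurable (der p) volume ∧
    Integrable (fun y => (L ^ 2 + y ^ 2) * prim (der p) y ^ 2) ∧ Integrable (fun y => (L ^ 2 + y ^ 2) * der p y ^ 2) ∧
    Real.sqrt (∫ y, (L ^ 2 + y ^ 2) * prim (der p) y ^ 2) = 2 * ‖(p : WithLp 2 (W L × W L)).fst‖ ∧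
    Real.sqrt (∫ y, (L ^ 2 + y ^ 2) * der p y ^ 2) = ‖(p : WithLp 2 (W L × W L)).snd‖ := by
  obtain ⟨-, -, hm, h0, h1, e0, e1⟩ := energyClass_of_mem hL p
  refine ⟨(continuous_prim hL _).aestronglyMeasurable, hm, h0, h1, ?_, ?_⟩
  · rw [der_def, e0, show (4 : ℝ) * ‖(p : WithLp 2 (W L × W L)).fst‖ ^ 2 = (2 * ‖(p : WithLp 2 (W L × W L)).fst‖) ^ 2 by ring,
      Real.sqrt_sq (by positivity)]
  · rw [der_def, e1, Real.sqrt_sq (norm_nonneg _)]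

section Assembly

variable {L D₀ D₁ V₀ : ℝ} {d V : ℝ → ℝ}

/-- `linForm` of an energy-space profile against a test: integrable, with the fixed-test bound `≤ K(v)·‖p‖`. [folklore] -/
theorem abs_linForm_profile_le (hL : 0 < L) (hdm : AEStronglyMeasurable d volume) (hVm : AEStronglyMeasurable V volume)
    (hD₁ : 0 ≤ D₁) (hd : ∀ ξ, |d ξ| ≤ D₀ + D₁ * |ξ|) (hV : ∀ ξ, |V ξ| ≤ V₀) (vp : testSpace) (p : Esp L hL) :
    Integrable (fun y => (L ^ 2 + y ^ 2) * (der p y * vp.1.2 y) + 2 * y * (der p y * vp.1.1 y)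
        + (L ^ 2 + y ^ 2) * d y * (der p y * vp.1.1 y) + (L ^ 2 + y ^ 2) * V y * (prim (der p) y * vp.1.1 y)) ∧
    |linForm L d V (prim (der p)) (der p) vp.1.1 vp.1.2| ≤
      ((Real.sqrt (∫ y, (L ^ 2 + y ^ 2) * vp.1.2 y ^ 2) + Real.sqrt (∫ y, (L ^ 2 + y ^ 2) * (2 * y * vp.1.1 y / (L ^ 2 + y ^ 2)) ^ 2)
          + Real.sqrt (∫ y, (L ^ 2 + y ^ 2) * (d y * vp.1.1 y) ^ 2)) + 2 * Real.sqrt (∫ y, (L ^ 2 + y ^ 2) * (V y * vp.1.1 y) ^ 2)) * ‖p‖ := by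
  obtain ⟨hum, hu₁m, h0, h1, e0, e1⟩ := profile_facts hL p
  obtain ⟨hint, hle⟩ := abs_linForm_le hL hdm hVm hD₁ hd hV vp.2 hum hu₁m h0 h1
  refine ⟨hint, hle.trans ?_⟩
  rw [e0, e1]
  have hf : ‖(p : WithLp 2 (W L × W L)).fst‖ ≤ ‖p‖ := WithLp.norm_fst_le (x := (p : WithLp 2 (W L × W L)))
  have hs : ‖(p : WithLp 2 (W L × W L)).snd‖ ≤ ‖p‖ := WithLp.norm_snd_le (x := (p : WithLp 2 (W L × W L)))
  have hA : 0 ≤ Real.sqrt (∫ y, (L ^ 2 + y ^ 2) * vp.1.2 y ^ 2) + Real.sqrt (∫ y, (L ^ 2 + y ^ 2) * (2 * y * vp.1.1 y / (L ^ 2 + y ^ 2)) ^ 2)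
      + Real.sqrt (∫ y, (L ^ 2 + y ^ 2) * (d y * vp.1.1 y) ^ 2) := by positivity
  have hB : 0 ≤ Real.sqrt (∫ y, (L ^ 2 + y ^ 2) * (V y * vp.1.1 y) ^ 2) := Real.sqrt_nonneg _
  nlinarith [mul_le_mul_of_nonneg_left hs hA, mul_le_mul_of_nonneg_left hf hB]

/-- **The weak form as a bilinear map** `Esp L hL →ₗ testSpace →ₗ ℝ`: `(p, (v, v₁)) ↦ linForm L d V (prim (der p)) (der p) v v₁`. [folklore] -/
def Eform (hL : 0 < L) (hdm : AEStronglyMeasurable d volume) (hVm : AEStronglyMeasurable V volume)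
    (hD₁ : 0 ≤ D₁) (hd : ∀ ξ, |d ξ| ≤ D₀ + D₁ * |ξ|) (hV : ∀ ξ, |V ξ| ≤ V₀) : Esp L hL →ₗ[ℝ] testSpace →ₗ[ℝ] ℝ :=
  LinearMap.mk₂ ℝ (fun (p : Esp L hL) (vp : testSpace) => linForm L d V (prim (der p)) (der p) vp.1.1 vp.1.2)
    (by
      intro p q vp
      obtain ⟨hae, hprim⟩ := der_add hL p q
      rw [linForm_congr_ae L d V (Eventually.of_forall fun y => congrFun hprim y) hae]
      exact linForm_add_left L d V (abs_linForm_profile_le hL hdm hVm hD₁ hd hV vp p).1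
        (abs_linForm_profile_le hL hdm hVm hD₁ hd hV vp q).1)
    (by
      intro c p vp
      obtain ⟨hae, hprim⟩ := der_smul hL c p
      rw [linForm_congr_ae L d V (Eventually.of_forall fun y => congrFun hprim y) hae, smul_eq_mul]
      exact linForm_smul_left L d V c)
    (by
      intro p vp vq
      change linForm L d V _ _ (fun y => vp.1.1 y + vq.1.1 y) (fun y => vp.1.2 y + vq.1.2 y) = _
      exact linForm_add_right L d V (abs_linForm_profile_le hL hdm hVm hD₁ hd hV vp p).1
        (abs_linForm_profile_le hL hdm hVm hD₁ hd hV vq p).1)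
    (by
      intro c p vp
      change linForm L d V _ _ (fun y => c * vp.1.1 y) (fun y => c * vp.1.2 y) = _
      rw [smul_eq_mul]
      exact linForm_smul_right L d V c)

/-- Unfolding `Eform`. [folklore] -/
theorem Eform_apply (hL : 0 < L) (hdm : AEStronglyMeasurable d volume) (hVm : AEStronglyMeasurable V volume)
    (hD₁ : 0 ≤ D₁) (hd : ∀ ξ, |d ξ| ≤ D₀ + D₁ * |ξ|) (hV : ∀ ξ, |V ξ| ≤ V₀) (p : Esp L hL) (vp : testSpace) :
    Eform hL hdm hVm hD₁ hd hV p vp = linForm L d V (prim (der p)) (der p) vp.1.1 vp.1.2 := by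
  simp only [Eform, LinearMap.mk₂_apply]

/-- The weighted product of an `L²_w` class with a test is integrable. [folklore] -/
theorem integrable_weight_mul_test (hL : 0 < L) (g : W L) {v v₁ : ℝ → ℝ} (hv : IsCompactTest v v₁) :
    Integrable fun y => (L ^ 2 + y ^ 2) * ((g : ℝ → ℝ) y * v y) := by
  obtain ⟨hc, -, -, -⟩ := basic_of_isCompactTest hv
  have h := (integral_weight_abs_mul_le (L := L) (aestronglyMeasurable_of_W hL g) hc.aestronglyMeasurable
    (weightedSq_of_W hL g) (weighted_of_isCompactTest (L := L) hv).1).1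
  refine h.mono' ((by fun_prop : AEStronglyMeasurable (fun y : ℝ => L ^ 2 + y ^ 2) volume).mul
    ((aestronglyMeasurable_of_W hL g).mul hc.aestronglyMeasurable)) (Eventually.of_forall fun y => ?_)
  rw [Real.norm_eq_abs, abs_mul, abs_of_nonneg (by positivity : (0:ℝ) ≤ L ^ 2 + y ^ 2)]

/-- **The data pairing** `(g, (v, v₁)) ↦ ∫ (L²+ξ²) g v` as a bilinear map `W L →ₗ testSpace →ₗ ℝ`. [folklore] -/
def Pdata (hL : 0 < L) : W L →ₗ[ℝ] testSpace →ₗ[ℝ] ℝ :=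
  LinearMap.mk₂ ℝ (fun (g : W L) (vp : testSpace) => ∫ y, (L ^ 2 + y ^ 2) * ((g : ℝ → ℝ) y * vp.1.1 y))
    (by
      intro g g' vp
      have hae : ((g + g' : W L) : ℝ → ℝ) =ᵐ[volume] (fun y => (g : ℝ → ℝ) y + (g' : ℝ → ℝ) y) :=
        ae_volume_of_ae_μw hL (Lp.coeFn_add g g')
      rw [← integral_add (integrable_weight_mul_test hL g vp.2) (integrable_weight_mul_test hL g' vp.2)]
      refine integral_congr_ae (hae.mono fun y hy => ?_)
      simp only [hy]; ring)
    (by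
      intro c g vp
      have hae : ((c • g : W L) : ℝ → ℝ) =ᵐ[volume] (fun y => c * (g : ℝ → ℝ) y) :=
        (ae_volume_of_ae_μw hL (Lp.coeFn_smul c g)).mono fun y hy => by rw [hy, Pi.smul_apply, smul_eq_mul]
      rw [smul_eq_mul, ← integral_const_mul]
      refine integral_congr_ae (hae.mono fun y hy => ?_)
      simp only [hy]; ring)
    (by
      intro g vp vq
      change ∫ y, (L ^ 2 + y ^ 2) * ((g : ℝ → ℝ) y * (vp.1.1 y + vq.1.1 y)) = _
      rw [← integral_add (integrable_weight_mul_test hL g vp.2) (integrable_weight_mul_test hL g vq.2)]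
      refine integral_congr_ae (Eventually.of_forall fun y => ?_)
      ring)
    (by
      intro c g vp
      change ∫ y, (L ^ 2 + y ^ 2) * ((g : ℝ → ℝ) y * (c * vp.1.1 y)) = _
      rw [smul_eq_mul, ← integral_const_mul]
      refine integral_congr_ae (Eventually.of_forall fun y => ?_)
      ring)

/-- Unfolding `Pdata`. [folklore] -/
theorem Pdata_apply (hL : 0 < L) (g : W L) (vp : testSpace) :
    Pdata hL g vp = ∫ y, (L ^ 2 + y ^ 2) * ((g : ℝ → ℝ) y * vp.1.1 y) := by
  simp only [Pdata, LinearMap.mk₂_apply]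

/-- The data bound: `|∫ w g v| ≤ 2‖g‖·‖jmap (v, v₁)‖` (`‖v‖_w ≤ 2‖jmap(v,v₁)‖`). [folklore] -/
theorem abs_Pdata_le (hL : 0 < L) (g : W L) (vp : testSpace) : |Pdata hL g vp| ≤ 2 * ‖g‖ * ‖jmap hL vp‖ := by
  obtain ⟨hc, -, -, -⟩ := basic_of_isCompactTest vp.2
  have hwv := (weighted_of_isCompactTest (L := L) vp.2).1
  obtain ⟨hi, hb⟩ := integral_weight_abs_mul_le (L := L) (aestronglyMeasurable_of_W hL g) hc.aestronglyMeasurable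
    (weightedSq_of_W hL g) hwv
  rw [Pdata_apply]
  have h1 : |∫ y, (L ^ 2 + y ^ 2) * ((g : ℝ → ℝ) y * vp.1.1 y)| ≤ ∫ y, (L ^ 2 + y ^ 2) * |(g : ℝ → ℝ) y * vp.1.1 y| := by
    rw [← Real.norm_eq_abs]
    refine (norm_integral_le_integral_norm _).trans (le_of_eq (integral_congr_ae (Eventually.of_forall fun y => ?_)))
    show ‖(L ^ 2 + y ^ 2) * ((g : ℝ → ℝ) y * vp.1.1 y)‖ = (L ^ 2 + y ^ 2) * |(g : ℝ → ℝ) y * vp.1.1 y|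
    rw [Real.norm_eq_abs, abs_mul, abs_of_nonneg (by positivity : (0:ℝ) ≤ L ^ 2 + y ^ 2)]
  have hv : Real.sqrt (∫ y, (L ^ 2 + y ^ 2) * vp.1.1 y ^ 2) ≤ 2 * ‖jmap hL vp‖ := by
    have hsq := sq_norm_jmap hL vp
    have hnn : 0 ≤ ∫ y, (L ^ 2 + y ^ 2) * vp.1.2 y ^ 2 := integral_nonneg fun y => by positivity
    have : ∫ y, (L ^ 2 + y ^ 2) * vp.1.1 y ^ 2 ≤ (2 * ‖jmap hL vp‖) ^ 2 := by nlinarith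
    calc Real.sqrt (∫ y, (L ^ 2 + y ^ 2) * vp.1.1 y ^ 2) ≤ Real.sqrt ((2 * ‖jmap hL vp‖) ^ 2) := Real.sqrt_le_sqrt this
      _ = 2 * ‖jmap hL vp‖ := Real.sqrt_sq (by positivity)
  rw [← norm_W] at hb
  calc |∫ y, (L ^ 2 + y ^ 2) * ((g : ℝ → ℝ) y * vp.1.1 y)| ≤ ‖g‖ * Real.sqrt (∫ y, (L ^ 2 + y ^ 2) * vp.1.1 y ^ 2) := h1.trans hb
    _ ≤ ‖g‖ * (2 * ‖jmap hL vp‖) := mul_le_mul_of_nonneg_left hv (norm_nonneg _)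
    _ = 2 * ‖g‖ * ‖jmap hL vp‖ := by ring

/-- `Eform` on the diagonal of a test is the function-language `linForm(v; v)`. [folklore] -/
theorem Eform_jmap (hL : 0 < L) (hdm : AEStronglyMeasurable d volume) (hVm : AEStronglyMeasurable V volume)
    (hD₁ : 0 ≤ D₁) (hd : ∀ ξ, |d ξ| ≤ D₀ + D₁ * |ξ|) (hV : ∀ ξ, |V ξ| ≤ V₀) (vp : testSpace) :
    Eform hL hdm hVm hD₁ hd hV (jmap hL vp) vp = linForm L d V vp.1.1 vp.1.2 vp.1.1 vp.1.2 := by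
  rw [Eform_apply]
  obtain ⟨hae, hprim⟩ := jmap_snd_ae hL vp
  exact linForm_congr_ae L d V (Eventually.of_forall fun y => congrFun hprim y) hae

/-- **THE SOLUTION OPERATOR.**  Under `κ`-coercivity of the linearised form on compactly supported tests there is a bounded LINEAR
`S : W L →L[ℝ] Esp L hL` whose values solve the weak equation against every compactly supported test, with `‖S g‖ ≤ (2/κ)‖g‖`. [folklore] -/
theorem exists_solutionOperator (hL : 0 < L) (hdm : AEStronglyMeasurable d volume) (hVm : AEStronglyMeasurable V volume)
    (hD₁ : 0 ≤ D₁) (hd : ∀ ξ, |d ξ| ≤ D₀ + D₁ * |ξ|) (hV : ∀ ξ, |V ξ| ≤ V₀) {κ : ℝ} (hκ : 0 < κ)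
    (hcoer : ∀ v v₁ : ℝ → ℝ, IsCompactTest v v₁ →
      κ * ((∫ ξ, (L ^ 2 + ξ ^ 2) * v₁ ξ ^ 2) + 1 / 4 * ∫ ξ, (L ^ 2 + ξ ^ 2) * v ξ ^ 2) ≤ linForm L d V v v₁ v v₁) :
    ∃ S : W L →L[ℝ] Esp L hL,
      (∀ (g : W L) (v v₁ : ℝ → ℝ), IsCompactTest v v₁ →
        linForm L d V (prim (der (S g))) (der (S g)) v v₁ = ∫ y, (L ^ 2 + y ^ 2) * ((g : ℝ → ℝ) y * v y)) ∧
      ∀ g : W L, ‖S g‖ ≤ 2 / κ * ‖g‖ := by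
  haveI : CompleteSpace (Esp L hL) := completeSpace_Esp hL
  have hE : ∀ vp : testSpace, ∃ K : ℝ, ∀ p : Esp L hL, |Eform hL hdm hVm hD₁ hd hV p vp| ≤ K * ‖p‖ := fun vp =>
    ⟨_, fun p => by rw [Eform_apply]; exact (abs_linForm_profile_le hL hdm hVm hD₁ hd hV vp p).2⟩
  have hcoer' : ∀ vp : testSpace, κ * ‖jmap hL vp‖ ^ 2 ≤ Eform hL hdm hVm hD₁ hd hV (jmap hL vp) vp := by
    intro vp
    rw [Eform_jmap, sq_norm_jmap]
    have h := hcoer vp.1.1 vp.1.2 vp.2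
    linarith
  obtain ⟨S, hS, hSn⟩ := exists_solutionOperator_of_coercive (F := Esp L hL) (jmap hL) (fun vp => ‖jmap hL vp‖)
    (fun _ => norm_nonneg _) (C := 1) zero_le_one (fun vp => by rw [one_mul]) (Eform hL hdm hVm hD₁ hd hV) hE hκ hcoer'
    (Pdata hL) (CP := 2) (by norm_num) (fun g vp => abs_Pdata_le hL g vp)
  refine ⟨S, fun g v v₁ hv => ?_, fun g => ?_⟩
  · have h := hS g ⟨(v, v₁), hv⟩
    rw [Eform_apply, Pdata_apply] at h
    exact h
  · have h := hSn g
    calc ‖S g‖ ≤ 2 * (1 / κ) * ‖g‖ := h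
      _ = 2 / κ * ‖g‖ := by ring

/-! ### Uniqueness: every energy-space weak solution is `S g` -/

/-- Two elements of `Esp` with the same profile `prim (der p)` coincide. [folklore] -/
theorem ext_of_prim_eq (hL : 0 < L) {p q : Esp L hL} (h : ∀ x, prim (der p) x = prim (der q) x) : p = q := by
  have hμ : μw L ≪ volume := by rw [μw_eq]; exact withDensity_absolutelyContinuous _ _
  -- second components: `∫₀ˣ (p₁ − q₁) = 0` for all `x`, so `p₁ = q₁` a.e.
  set f : ℝ → ℝ := fun y => der p y - der q y with hf
  have hfloc : LocallyIntegrable f volume :=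
    ((memLp_two_of_weighted_sq hL (aestronglyMeasurable_of_W hL _) (weightedSq_of_W hL _)).sub
      (memLp_two_of_weighted_sq hL (aestronglyMeasurable_of_W hL _) (weightedSq_of_W hL _))).locallyIntegrable one_le_two
  have hF : (fun x => ∫ t in (0 : ℝ)..x, f t) = fun _ => (0 : ℝ) := by
    funext x
    rw [hf, intervalIntegral.integral_sub (intervalIntegrable_of_W hL _ 0 x) (intervalIntegrable_of_W hL _ 0 x)]
    have := h x
    simp only [prim_apply] at this
    linarith
  have hsnd_ae : der p =ᵐ[volume] der q := by
    filter_upwards [_root_.LocallyIntegrable.ae_hasDerivAt_integral hfloc] with y hy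
    have hy0 := hy 0
    rw [hF] at hy0
    have hzero : f y = 0 := hy0.unique (hasDerivAt_const y (0 : ℝ))
    simp only [hf] at hzero
    linarith
  have hsnd : ((p : WithLp 2 (W L × W L)).snd : W L) = ((q : WithLp 2 (W L × W L)).snd : W L) := Lp.ext (hμ.ae_le hsnd_ae)
  -- first components: `2p₀ = prim p₁ = prim q₁ = 2q₀` a.e.
  have hfst_ae : ((((p : WithLp 2 (W L × W L)).fst : W L) : ℝ → ℝ)) =ᵐ[volume] ((((q : WithLp 2 (W L × W L)).fst : W L) : ℝ → ℝ)) := by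
    filter_upwards [prim_snd_ae_eq hL p, prim_snd_ae_eq hL q] with y hp hq
    have := h y
    simp only [der_def] at this
    linarith
  have hfst : ((p : WithLp 2 (W L × W L)).fst : W L) = ((q : WithLp 2 (W L × W L)).fst : W L) := Lp.ext (hμ.ae_le hfst_ae)
  apply Subtype.ext
  exact WithLp.ofLp_injective 2 (Prod.ext hfst hsnd)

/-- `linForm` is subtractive in the profile slot (under integrability). [folklore] -/
theorem linForm_sub_left {u u₁ u' u₁' v v₁ : ℝ → ℝ}
    (hi : Integrable (fun y => (L ^ 2 + y ^ 2) * (u₁ y * v₁ y) + 2 * y * (u₁ y * v y) + (L ^ 2 + y ^ 2) * d y * (u₁ y * v y)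
        + (L ^ 2 + y ^ 2) * V y * (u y * v y)))
    (hi' : Integrable (fun y => (L ^ 2 + y ^ 2) * (u₁' y * v₁ y) + 2 * y * (u₁' y * v y) + (L ^ 2 + y ^ 2) * d y * (u₁' y * v y)
        + (L ^ 2 + y ^ 2) * V y * (u' y * v y))) :
    linForm L d V (fun y => u y - u' y) (fun y => u₁ y - u₁' y) v v₁ = linForm L d V u u₁ v v₁ - linForm L d V u' u₁' v v₁ := by
  unfold linForm
  rw [← integral_sub hi hi']
  refine integral_congr_ae (Eventually.of_forall fun y => ?_)
  ring

/-- **Uniqueness**: two energy-space weak solutions with the same right-hand side coincide (so every energy-space weak solution with datum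
`g` equals `S g`) — `SheetRLinearisedUniqueness.weak_solution_unique` + `ext_of_prim_eq`. [folklore] -/
theorem solution_unique (hL : 0 < L) (hdm : AEStronglyMeasurable d volume) (hVm : AEStronglyMeasurable V volume)
    (hD₀ : 0 ≤ D₀) (hD₁ : 0 ≤ D₁) (hd : ∀ ξ, |d ξ| ≤ D₀ + D₁ * |ξ|) (hV : ∀ ξ, |V ξ| ≤ V₀) {κ : ℝ} (hκ : 0 < κ)
    (hcoer : ∀ v v₁ : ℝ → ℝ, IsCompactTest v v₁ →
      κ * ((∫ ξ, (L ^ 2 + ξ ^ 2) * v₁ ξ ^ 2) + 1 / 4 * ∫ ξ, (L ^ 2 + ξ ^ 2) * v ξ ^ 2) ≤ linForm L d V v v₁ v v₁)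
    {rhs : (ℝ → ℝ) → (ℝ → ℝ) → ℝ} {p q : Esp L hL}
    (hp : ∀ v v₁ : ℝ → ℝ, IsCompactTest v v₁ → linForm L d V (prim (der p)) (der p) v v₁ = rhs v v₁)
    (hq : ∀ v v₁ : ℝ → ℝ, IsCompactTest v v₁ → linForm L d V (prim (der q)) (der q) v v₁ = rhs v v₁) : p = q := by
  obtain ⟨hu, hodd, hm, h0, h1, -, -⟩ := energyClass_of_mem hL p
  obtain ⟨hu', hodd', hm', h0', h1', -, -⟩ := energyClass_of_mem hL q
  refine ext_of_prim_eq hL (SheetRLinearisedUniqueness.weak_solution_unique hL hdm hVm hD₀ hD₁ hd hV hκ hcoer hu hodd hm h0 h1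
    hu' hodd' hm' h0' h1' hp hq fun φ φ₁ hφ => ?_)
  exact linForm_sub_left (abs_linForm_profile_le hL hdm hVm hD₁ hd hV ⟨(φ, φ₁), hφ⟩ p).1
    (abs_linForm_profile_le hL hdm hVm hD₁ hd hV ⟨(φ, φ₁), hφ⟩ q).1

end Assembly

end SheetRSolutionOperator
end Summit.NavierStokesRegularity.OSWSelfSimilar

end
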